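import Summits.NavierStokesRegularity.NavierStokesRegularity.Theses.LebesgueExponentPincer
import Literature.Analysis.FluidPDE.NSQuasipotential
import Literature.Analysis.FluidPDE.LerayLocalRegularH1Proofs

/-!
# Crux `StrongCriticalityBreaking` (stmt-NavierStokesRegularity-19241, route `LebesgueExponentPincer`),
# negative side: non-vacuity; the classical clause is load-bearing (through the representative)

Negative-side (refuter birth vetting `rattack`, D-0016) lemmas extracted from the crux work file
`Cruxes/StrongCriticalityBreaking/Disproof.lean` (2026-08-17), importable by the line's provers.
Nothing here closes the item (`--supports`); no theorem concludes a Theses statement positively.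

The crux K2 (Barker–Prange *strong* criticality breaking, arXiv:2012.09776 p.2, restricted to first
blow-up times of smooth flows from rapidly decaying data): `∃ δ ∈ (0,1), ∀ ν T > 0, ∀ (u, p)`
classical NS on `[0,T)`, Leray–Hopf on `[0,T]` from `u 0`, `u 0` rapidly decaying,
`sup_{t∈[0,T)} ‖u t‖_{L^{3-δ}} < ∞ ⟹ HasSmoothExtensionPast ν 0 u T`.

* `strongCriticalityBreaking_hypotheses_satisfiable` — NON-VACUITY: the rest state (`ν = T = 1`) is
  classical on `[0, 1)`, Leray–Hopf from the rapidly decaying datum `0`, and its supercritical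
  `ℝ≥0∞`-supremum evaluates honestly to `0 < ⊤` (no junk); `conclusion_holds_at_rest`: there the
  conclusion holds (extend by rest), so the only constructible model does not refute.
* `strongCriticalityBreaking_false_without_classical` — with the clause
  `IsClassicalNSSolutionOn (Ico 0 T) ν 0 u p` DELETED the statement is FALSE for EVERY `δ`. Witness:
  the rest state spiked by the unit vector `e0` at the single space–time point `(1/2, 0)`. Every
  clause of `IsLerayHopfOn` reads slices a.e. (tree `isLerayHopfOn_zero`,
  `IsLerayHopfOn.congr_ae_slices`), the `eLpNorm`-supremum ignores null sets and the datum `u 0 = 0`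
  is untouched, so all remaining hypotheses hold; but a classical extension past `T = 1` must
  reproduce the slice `u (1/2)` POINTWISE on `Ico 0 1`, and that slice is discontinuous at `0`.
  MEANING FOR PROVERS: the conclusion `HasSmoothExtensionPast` is about the continuous
  representative; any weak / mild-class step (weak–strong uniqueness, ε-regularity, the quantitative
  `L^{3-δ}` machinery) must be returned to that representative through the classical clause.
* The side condition `0 < T` only excludes a degenerate-TRUE instance (`Ico 0 T = ∅`): decoration,
  not load-bearing — already in the tree as `Theorems.Target.Negative.hasSmoothExtensionPast_of_nonpos`.
-/

set_option linter.dupNamespace false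

noncomputable section

open MeasureTheory Set Function Filter
open scoped Topology ENNReal
open Literature.Analysis.FluidPDE
open Summit.NavierStokesRegularity.NavierStokesRegularity.Theses.LebesgueExponentPincer

namespace Summit.NavierStokesRegularity.NavierStokesRegularity.Theorems.StrongCriticalityBreaking.Negative

/-- Local notation for physical space `ℝ³ = EuclideanSpace ℝ (Fin 3)`. -/
local notation "ℝ³" => EuclideanSpace ℝ (Fin 3)

/-! ## §1 Non-vacuity and the rest state -/

/-- The supercritical sup-norm hypothesis evaluates to `0` at the rest state (no junk). [folklore] -/
theorem iSup_eLpNorm_zero (T q : ℝ) :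
    (⨆ t ∈ Set.Ico 0 T, eLpNorm ((0 : ℝ → ℝ³ → ℝ³) t) (ENNReal.ofReal q) volume) = 0 := by
  simp

/-- **Non-vacuity**: all four hypotheses of the crux hold at once (rest state, `ν = T = 1`, every
exponent `3 - δ`). [folklore] -/
theorem strongCriticalityBreaking_hypotheses_satisfiable (δ : ℝ) :
    ∃ (ν T : ℝ) (u : ℝ → ℝ³ → ℝ³) (p : ℝ → ℝ³ → ℝ), 0 < ν ∧ 0 < T ∧
      IsClassicalNSSolutionOn (Set.Ico 0 T) ν 0 u p ∧ IsLerayHopfOn T ν 0 (u 0) u ∧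
      HasRapidSpatialDecay (u 0) ∧
      (⨆ t ∈ Set.Ico 0 T, eLpNorm (u t) (ENNReal.ofReal (3 - δ)) volume) < ⊤ := by
  refine ⟨1, 1, 0, 0, one_pos, one_pos, isClassicalNSSolutionOn_zero _ 1,
    isLerayHopfOn_zero (E := ℝ³) 1 1, fun n K => ⟨0, fun x => ?_⟩, ?_⟩
  · rw [Pi.zero_apply, iteratedFDeriv_zero]
    simp
  · rw [iSup_eLpNorm_zero]
    exact ENNReal.zero_lt_top

/-- **The junk model does not refute**: at rest the conclusion holds (extend by rest). [folklore] -/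
theorem conclusion_holds_at_rest (ν T : ℝ) :
    HasSmoothExtensionPast ν 0 (0 : ℝ → ℝ³ → ℝ³) T :=
  ⟨T + 1, lt_add_one T, 0, 0, isClassicalNSSolutionOn_zero _ ν, fun _ _ => rfl⟩

/-! ## §2 The classical clause is load-bearing (through the representative) -/

/-- The crux with the clause `IsClassicalNSSolutionOn (Set.Ico 0 T) ν 0 u p` DELETED (the pressure
binder then carries nothing and is dropped too); everything else verbatim. -/
def StrongCriticalityBreakingWithoutClassical : Prop :=
  ∃ δ : ℝ, 0 < δ ∧ δ < 1 ∧ ∀ (ν T : ℝ), 0 < ν → 0 < T →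
    ∀ (u : ℝ → EuclideanSpace ℝ (Fin 3) → EuclideanSpace ℝ (Fin 3)),
    Literature.Analysis.FluidPDE.IsLerayHopfOn T ν 0 (u 0) u →
    Literature.Analysis.FluidPDE.HasRapidSpatialDecay (u 0) →
    (⨆ t ∈ Set.Ico 0 T, MeasureTheory.eLpNorm (u t) (ENNReal.ofReal (3 - δ)) MeasureTheory.volume)
      < ⊤ →
    Literature.Analysis.FluidPDE.HasSmoothExtensionPast ν 0 u T

/-- A fixed nonzero vector `e₀ = (1,0,0)`. -/
def e0 : ℝ³ := EuclideanSpace.single 0 1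

/-- **The witness**: the rest state spiked by `e₀` at the single space–time point `(1/2, 0)`. -/
def spike : ℝ → ℝ³ → ℝ³ := fun t x => if t = 1 / 2 ∧ x = 0 then e0 else 0

/-- The datum of the spike is the rest state. -/
theorem spike_time_zero : spike 0 = 0 := by
  funext x
  simp [spike]

/-- The value of the spike at the spiked point. -/
theorem spike_half_zero : spike (1 / 2) 0 = e0 := by
  simp [spike]

/-- Off the origin the spike vanishes at all times. -/
theorem spike_of_ne {t : ℝ} {x : ℝ³} (hx : x ≠ 0) : spike t x = 0 := by
  simp [spike, hx]

/-- Every slice of the spike is a.e. the zero field (it differs from `0` at most at `x = 0`). -/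
theorem spike_slice_ae (t : ℝ) : spike t =ᵐ[volume] (0 : ℝ → ℝ³ → ℝ³) t := by
  have hnull : volume ({0} : Set ℝ³) = 0 := measure_singleton 0
  refine measure_mono_null (fun x hx => ?_) hnull
  by_contra h0
  exact hx (by simp [spike_of_ne h0])

/-- The spike is a.e. the zero space–time field (it differs from `0` at most at `(1/2, 0)`). -/
theorem uncurry_spike_ae :
    Function.uncurry spike =ᵐ[volume] fun _ : ℝ × ℝ³ => (0 : ℝ³) := by
  have : NullSingletonClass (volume : Measure (ℝ × ℝ³)) :=
    Measure.prod.instNullSingletonClass_fst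
  have hnull : volume ({((1 : ℝ) / 2, (0 : ℝ³))} : Set (ℝ × ℝ³)) = 0 := measure_singleton _
  refine measure_mono_null (fun z hz => ?_) hnull
  obtain ⟨t, x⟩ := z
  by_contra h0
  have hx : ¬ (t = 1 / 2 ∧ x = 0) := fun h => h0 (by rw [h.1, h.2]; rfl)
  have hval : spike t x = 0 := if_neg hx
  exact hz hval

/-- **The spike is Leray–Hopf from the datum `0`** on every `[0, T)`, `T > 0`, for every `ν`
(a.e.-modification of the resting Leray–Hopf solution; tree `isLerayHopfOn_zero`,
`IsLerayHopfOn.congr_ae_slices`). [folklore] -/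
theorem isLerayHopfOn_spike {ν T : ℝ} (hT : 0 < T) : IsLerayHopfOn T ν 0 (spike 0) spike := by
  rw [spike_time_zero]
  have hae : (fun _ : ℝ × ℝ³ => (0 : ℝ³)) =ᵐ[(volume : Measure (ℝ × ℝ³)).restrict (Ioo 0 T ×ˢ univ)]
      Function.uncurry spike :=
    Filter.EventuallyEq.symm (ae_restrict_of_ae uncurry_spike_ae)
  have hvm : AEStronglyMeasurable (Function.uncurry spike)
      ((volume : Measure (ℝ × ℝ³)).restrict (Ioo 0 T ×ˢ univ)) :=
    (aestronglyMeasurable_const (b := (0 : ℝ³))).congr hae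
  exact (isLerayHopfOn_zero (E := ℝ³) T ν).congr_ae_slices hT hvm fun t _ => spike_slice_ae t

/-- The datum of the spike is the rapidly decaying rest state. [folklore] -/
theorem hasRapidSpatialDecay_spike_zero : HasRapidSpatialDecay (spike 0) := by
  rw [spike_time_zero]
  intro n K
  refine ⟨0, fun x => ?_⟩
  rw [iteratedFDeriv_zero]
  simp

/-- The supercritical supremum of the spike is `0` (the seminorm ignores null sets). [folklore] -/
theorem iSup_eLpNorm_spike (T : ℝ) (q : ℝ≥0∞) :
    (⨆ t ∈ Set.Ico 0 T, eLpNorm (spike t) q volume) = 0 := by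
  have h : ∀ t, eLpNorm (spike t) q volume = 0 := fun t => by
    rw [eLpNorm_congr_ae (spike_slice_ae t)]
    simp
  simp [h]

/-- The spiked slice `spike (1/2)` is not continuous (at `0`), so no classical field reproduces it.
[folklore] -/
theorem not_continuous_spike_half : ¬ Continuous (spike (1 / 2)) := by
  intro hc
  have h1 : Tendsto (spike (1 / 2)) (𝓝[≠] (0 : ℝ³)) (𝓝 (spike (1 / 2) 0)) :=
    (hc.tendsto 0).mono_left nhdsWithin_le_nhds
  have h2 : Tendsto (spike (1 / 2)) (𝓝[≠] (0 : ℝ³)) (𝓝 0) := by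
    refine (tendsto_const_nhds (x := (0 : ℝ³))).congr' ?_
    exact eventually_nhdsWithin_of_forall fun x hx => (spike_of_ne hx).symm
  have h3 := tendsto_nhds_unique h1 h2
  rw [spike_half_zero] at h3
  have h4 := congrArg (fun v : ℝ³ => v 0) h3
  simp [e0] at h4

/-- **The spike admits no classical extension past any `T > 1/2`**: an extension is classical on
`Ico 0 T' ∋ 1/2`, hence has a continuous slice at `1/2`, and agrees with `spike (1/2)` there.
[folklore] -/
theorem not_hasSmoothExtensionPast_spike {ν T : ℝ} (hT : 1 / 2 < T) :
    ¬ HasSmoothExtensionPast ν 0 spike T := by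
  rintro ⟨T', hT', u', p', hcl, hagree⟩
  have hmem : (1 / 2 : ℝ) ∈ Ico 0 T := ⟨by norm_num, hT⟩
  have hmem' : (1 / 2 : ℝ) ∈ Ico 0 T' := ⟨by norm_num, hT.trans hT'⟩
  have hcont : Continuous (u' (1 / 2)) := (hcl.contDiff_velocity hmem').continuous
  rw [hagree _ hmem] at hcont
  exact not_continuous_spike_half hcont

/-- **`StrongCriticalityBreaking` is FALSE without its classical clause** ("any proof must use it,
and through the continuous representative"): for EVERY `δ` the spiked rest state (`ν = T = 1`) is
Leray–Hopf from the rapidly decaying datum `0`, has supercritical supremum `0 < ⊤`, and admits no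
classical extension past `T = 1 > 1/2`. [folklore] -/
theorem strongCriticalityBreaking_false_without_classical :
    ¬ StrongCriticalityBreakingWithoutClassical := by
  rintro ⟨δ, -, -, h⟩
  have hbd : (⨆ t ∈ Set.Ico 0 (1 : ℝ), eLpNorm (spike t) (ENNReal.ofReal (3 - δ)) volume) < ⊤ := by
    rw [iSup_eLpNorm_spike]
    exact ENNReal.zero_lt_top
  exact not_hasSmoothExtensionPast_spike (by norm_num)
    (h 1 1 one_pos one_pos spike (isLerayHopfOn_spike one_pos) hasRapidSpatialDecay_spike_zero hbd)

end Summit.NavierStokesRegularity.NavierStokesRegularity.Theorems.StrongCriticalityBreaking.Negative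

end
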